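import Mathlib

set_option linter.dupNamespace false

/-!
# Stub `stub_largeCoeff` — F3 (Cauchy–Schwarz extraction of a large coefficient)

Crux `stmt-MatrixMultiplication-10595` (`Theses.ThinBlockAlpha.ThinPackings`), line `Ideator4Sketch`
(card `automorphism-orbit-twisted-templates`).

A pure inequality (no group theory).  From the identity `∑ i, u i * v i * w i = K` one extracts an
index `i ≠ i₀` carrying a large coefficient `‖u i‖`:
`‖u i₀ v i₀ w i₀‖ − |K| ≤ ‖u i‖ · √(Pv · Pw)` whenever `∑ ‖v‖² ≤ Pv` and `∑ ‖w‖² ≤ Pw`.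

Proof.  Split off the `i₀` term, `∑_{i ≠ i₀} u v w = K − u i₀ v i₀ w i₀`, so by the reverse
triangle inequality `‖u i₀ v i₀ w i₀‖ − |K| ≤ ‖∑_{i ≠ i₀} u v w‖ ≤ ∑_{i ≠ i₀} ‖u i‖ ‖v i‖ ‖w i‖`.
Let `i*` maximise `‖u i‖` over `i ≠ i₀` (a nonempty range since `i₁ ≠ i₀`).  Then the last sum is at
most `‖u i*‖ · ∑_{i ≠ i₀} ‖v i‖ ‖w i‖ ≤ ‖u i*‖ · ∑_i ‖v i‖ ‖w i‖ ≤ ‖u i*‖ · √(Pv · Pw)` by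
Cauchy–Schwarz.
-/

namespace Summit.MatrixMultiplication.MatrixMultiplication.Theorems.ThinPackings.Orbit

open Finset

/-- **F3 (abstract Cauchy–Schwarz extraction).**  If `∑ i, u i * v i * w i = K` then some index
`i ≠ i₀` has `‖u i₀ * v i₀ * w i₀‖ − |K| ≤ ‖u i‖ · √(Pv · Pw)` whenever `∑ ‖v i‖² ≤ Pv` and
`∑ ‖w i‖² ≤ Pw` (the index `i₁ ≠ i₀` only witnesses that the punctured range is nonempty).
Registered stub `stub_largeCoeff` of the line's skeleton, verbatim. [new, elementary] -/
theorem stub_largeCoeff : ∀ {ι : Type} [Fintype ι] [DecidableEq ι] (i₀ i₁ : ι) (u v w : ι → ℂ) (K Pv Pw : ℝ), i₁ ≠ i₀ → (∑ i, u i * v i * w i : ℂ) = K → 0 ≤ Pv → 0 ≤ Pw → ∑ i, ‖v i‖ ^ 2 ≤ Pv → ∑ i, ‖w i‖ ^ 2 ≤ Pw → ∃ i, i ≠ i₀ ∧ (‖u i₀ * v i₀ * w i₀‖ - |K|) ≤ ‖u i‖ * Real.sqrt (Pv * Pw) := by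
  intro ι _ _ i₀ i₁ u v w K Pv Pw hi hsum hPv _hPw hv hw
  -- the punctured index range is nonempty, so `‖u ·‖` attains its maximum on it at some `j`
  have hne : ((univ : Finset ι).erase i₀).Nonempty := ⟨i₁, mem_erase.mpr ⟨hi, mem_univ _⟩⟩
  obtain ⟨j, hj, hjmax⟩ := exists_max_image ((univ : Finset ι).erase i₀) (fun i => ‖u i‖) hne
  refine ⟨j, (mem_erase.mp hj).1, ?_⟩
  -- split off the `i₀` term
  have hsplit : ∑ i ∈ (univ : Finset ι).erase i₀, u i * v i * w i = (K : ℂ) - u i₀ * v i₀ * w i₀ := by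
    rw [sum_erase_eq_sub (mem_univ i₀), hsum]
  -- Cauchy–Schwarz
  have hCS : ∑ i, ‖v i‖ * ‖w i‖ ≤ Real.sqrt (Pv * Pw) := by
    have h1 : (∑ i, ‖v i‖ * ‖w i‖) ^ 2 ≤ (∑ i, ‖v i‖ ^ 2) * ∑ i, ‖w i‖ ^ 2 :=
      sum_mul_sq_le_sq_mul_sq _ _ _
    have h2 : (∑ i, ‖v i‖ ^ 2) * ∑ i, ‖w i‖ ^ 2 ≤ Pv * Pw :=
      mul_le_mul hv hw (by positivity) hPv
    exact Real.le_sqrt_of_sq_le (h1.trans h2)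
  -- the main chain of inequalities
  calc ‖u i₀ * v i₀ * w i₀‖ - |K|
      = ‖u i₀ * v i₀ * w i₀‖ - ‖(K : ℂ)‖ := by rw [Complex.norm_real, Real.norm_eq_abs]
    _ ≤ ‖u i₀ * v i₀ * w i₀ - (K : ℂ)‖ := norm_sub_norm_le _ _
    _ = ‖∑ i ∈ (univ : Finset ι).erase i₀, u i * v i * w i‖ := by rw [hsplit, norm_sub_rev]
    _ ≤ ∑ i ∈ (univ : Finset ι).erase i₀, ‖u i * v i * w i‖ := norm_sum_le _ _
    _ = ∑ i ∈ (univ : Finset ι).erase i₀, ‖u i‖ * (‖v i‖ * ‖w i‖) := by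
        refine sum_congr rfl fun i _ => ?_
        rw [norm_mul, norm_mul, mul_assoc]
    _ ≤ ∑ i ∈ (univ : Finset ι).erase i₀, ‖u j‖ * (‖v i‖ * ‖w i‖) := by
        refine sum_le_sum fun i hi' => ?_
        exact mul_le_mul_of_nonneg_right (hjmax i hi') (by positivity)
    _ = ‖u j‖ * ∑ i ∈ (univ : Finset ι).erase i₀, ‖v i‖ * ‖w i‖ := by rw [mul_sum]
    _ ≤ ‖u j‖ * ∑ i, ‖v i‖ * ‖w i‖ :=
        mul_le_mul_of_nonneg_left (sum_le_univ_sum_of_nonneg fun i => by positivity)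
          (norm_nonneg _)
    _ ≤ ‖u j‖ * Real.sqrt (Pv * Pw) := mul_le_mul_of_nonneg_left hCS (norm_nonneg _)

end Summit.MatrixMultiplication.MatrixMultiplication.Theorems.ThinPackings.Orbit
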